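import Summits.CriticalPhenomena.PercolationContinuityZ3.Theorems.Transplant.Bcc111ClawTable5
import HarnessLib

/-!
# The bcc (111)-films `F_m(bcc)`, exit-form routing certificate II⁵H: the rule `clawH5` (both hub extremes kept) SUCCEEDS on the kernel class `(3, 3, 3, 3)` — chunks 1–4
# (kernel computation)

builds on p205010 (kernel theorem, internal audit signed; external expert review pending) — NOT used in this file.
Lane `prim-bschramm`, seat `prim-bschramm-p2` (gen 48; class C1b, METHOD = input substitution; memo `HOME/bschramm/P2-LATTICES.md` §159); helper file
(`--supports stmt-CriticalPhenomena-4575 --as helper`).  `decide +kernel` theorems (standard axioms, default heartbeats, no `native_decide`) towards «Bcc111ClawTable5».`ClawHOK5 s_R s_D`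
— the planar hexagonal claw rule with the STRENGTHENED hub test (needed at thickness `m = 5`) serves every admissible configuration of the class `(3, 3, s_R, s_D)` — in chunks of
the column of `E₁`, evaluated in the fast order (`ClawHOKL5F`, equal to `ClawHOKL5` by `clawHOKL5_iff_fast`).  The nine files «Bcc111ClawTable5OK{A,…,I}» cover the ten kernel
classes (`104 784` configurations; same candidate-leg table, kit `j339670`).
[cite: DuminilCopinSidoraviciusTassion2016, §2.3 (proof of Fact 2: the three disjoint paths in B̄_R(z) ∖ {z})]
-/

namespace Summit.CriticalPhenomena.PercolationContinuityZ3.Theorems.Transplant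

namespace Bcc111Claw

/-- Kernel class `(3, 3, 3, 3)`, rule `clawH5`, chunk 1 of the column of `E₁`: `[(-3, 0), (-3, 1), (-3, 2), (-3, 3), (-2, -1)]`. [folklore] -/
theorem clawHOKL5F_33_1 : ClawHOKL5F 3 3 [(-3, 0), (-3, 1), (-3, 2), (-3, 3), (-2, -1)] := by
  unfold ClawHOKL5F; decide +kernel

/-- Kernel class `(3, 3, 3, 3)`, rule `clawH5`, chunk 2 of the column of `E₁`: `[(-2, 0), (-2, 1), (-2, 2), (-2, 3), (-1, -2)]`. [folklore] -/
theorem clawHOKL5F_33_2 : ClawHOKL5F 3 3 [(-2, 0), (-2, 1), (-2, 2), (-2, 3), (-1, -2)] := by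
  unfold ClawHOKL5F; decide +kernel

/-- Kernel class `(3, 3, 3, 3)`, rule `clawH5`, chunk 3 of the column of `E₁`: `[(-1, -1), (-1, 0), (-1, 1), (-1, 2), (-1, 3)]`. [folklore] -/
theorem clawHOKL5F_33_3 : ClawHOKL5F 3 3 [(-1, -1), (-1, 0), (-1, 1), (-1, 2), (-1, 3)] := by
  unfold ClawHOKL5F; decide +kernel

/-- Kernel class `(3, 3, 3, 3)`, rule `clawH5`, chunk 4 of the column of `E₁`: `[(0, -3), (0, -2), (0, -1), (0, 0), (0, 1)]`. [folklore] -/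
theorem clawHOKL5F_33_4 : ClawHOKL5F 3 3 [(0, -3), (0, -2), (0, -1), (0, 0), (0, 1)] := by
  unfold ClawHOKL5F; decide +kernel

end Bcc111Claw

end Summit.CriticalPhenomena.PercolationContinuityZ3.Theorems.Transplant
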